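import Literature.Topology.CoveringSpaces.CoveringDeckTransformations
import Mathlib.Topology.Covering.Quotient
import HarnessLib

/-!
# Normal coverings are quotient coverings by their deck group, and conversely (Hatcher, §1.3, Prop. 1.40)

Topic `Literature/Topology/CoveringSpaces`; campaign-L R1 (topological Galois correspondence for
covering maps), part (B) «connected covers», file 4 — the bridge between the deck-transformation
picture of files 1–3 (Hatcher, Props. 1.37–1.39) and Mathlib's *quotient covering maps*
`IsQuotientCoveringMap p G` (`X = E/G` for a free, properly discontinuous action; with its
`fundamentalGroupToMulOpposite`, `ker_monodromyPerm`, … and the tree's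
`QuotientCovering.range_mapOfEq_eq_ker` / `index_range_mapOfEq`). Everything is PROVED; no
definition, no named fact. The `IsQuotientCoveringMap.*` theorems below are DELIBERATE dot-notation
extensions of Mathlib's namespace (parallel to the tree's `IsCoveringMap.of_comp` /
`IsQuotientCoveringMap.of_comp` in `CoveringMapOfComp.lean`).

Hatcher, Prop. 1.40: for a covering space action of `G` on `Y`, (a) `Y → Y/G` is a normal covering
space, (b) `G` is its group of deck transformations if `Y` is path connected, (c)
`G ≅ π₁(Y/G)/p_* π₁(Y)` if `Y` is path connected and locally path connected; and (proof of
Prop. 1.39 / p. 72) the deck group of a covering acts as a covering space action, so that a NORMAL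
covering `p : E → X` "is" the quotient covering `E → E/G(E)`.

* `isQuotientCoveringMap_of_smul` — **a group `G` acting continuously and faithfully on a connected
  covering space `E` by maps over `X`, transitively on the fibres, presents `p` as the quotient
  covering map `E → E/G = X`** (Mathlib `IsQuotientCoveringMap p G`): freeness of the action is
  unique lifting (two lifts of `p` agreeing at a point coincide), the rest is Mathlib's
  characterisation `isQuotientCoveringMap_iff_isCoveringMap_and`. Applied to `G = G(E)` (any
  faithful action of the deck group, e.g. `f • e = f e`) this is «a normal covering is the quotient
  covering by its deck group»;
* `IsQuotientCoveringMap.exists_monoidHom_range_eq_deckTransformations` — **conversely (Prop. 1.40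
  (b)) for a quotient covering map `p : E → X = E/G` with connected (nonempty) `E`, `g ↦ (g • ·)` is an
  injective homomorphism `G → (E ≃ₜ E)` whose image is EXACTLY the deck group** (a deck
  transformation agrees with some `g • ·` at one point, hence everywhere);
  `IsQuotientCoveringMap.nonempty_mulEquiv_deckTransformations` — `G ≃* G(E)`;
* `IsQuotientCoveringMap.forall_exists_deck_apply_eq` — a quotient covering is normal in the sense
  of file 3 (deck group transitive on every fibre), so that file 3's
  `CoverDeck.forall_exists_deck_apply_eq_iff_normal` / `nonempty_mulEquiv_quotient_of_normal` apply:
  `IsQuotientCoveringMap.normal_range_mapOfEq'` (recovering the tree's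
  `QuotientCovering.normal_range_mapOfEq` by the deck route) and, for Prop. 1.40 (c), the tree's
  `QuotientCovering.range_mapOfEq_eq_ker` / `index_range_mapOfEq` are already available by name.

## References

* A. Hatcher, *Algebraic Topology*, CUP 2002, §1.3 «Deck Transformations and Group Actions»,
  Prop. 1.39 (proof), Prop. 1.40 (pp. 70–72). [HatcherAT2002]
-/

noncomputable section

open Function

namespace Literature.Topology.CoveringSpaces

namespace CoverDeck

open Literature.Geometry.Kaehler.ComplexTorus (deckTransformations mem_deckTransformations_iff
  deck_eq_of_apply_eq deck_eq_one_of_apply_eq)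

variable {E X : Type*} [TopologicalSpace E] [TopologicalSpace X] {p : E → X}
  {G : Type*} [Group G] [MulAction G E]

/-! ### §1 Transitive actions over `X` present `p` as a quotient covering (Prop. 1.40 (a), and p. 72) -/

/-- **Freeness by unique lifting**: if `G` acts continuously and faithfully on a connected covering
space `E` by maps over `X`, then `g • e = g' • e` at ONE point forces `g = g'` (the two maps
`g • ·`, `g' • ·` are lifts of `p` through `p` agreeing at `e`; Hatcher: «only the identity deck
transformation can fix a point»). [cite: HatcherAT2002, §1.3 Prop. 1.40] -/
theorem eq_of_smul_eq_smul [PreconnectedSpace E] [ContinuousConstSMul G E] [FaithfulSMul G E]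
    (hp : IsCoveringMap p) (hover : ∀ (g : G) (e : E), p (g • e) = p e) {g g' : G} {e : E}
    (h : g • e = g' • e) : g = g' := by
  have key : (fun x : E => g • x) = fun x : E => g' • x :=
    hp.eq_of_comp_eq (continuous_const_smul g) (continuous_const_smul g')
      (funext fun x => (hover g x).trans (hover g' x).symm) e h
  exact FaithfulSMul.eq_of_smul_eq_smul fun x => congr_fun key x

/-- **Hatcher, Prop. 1.40 (a) with p. 72**: a group `G` acting continuously and faithfully on a
connected covering space `p : E → X` by maps over `X` (`p (g • e) = p e`) and TRANSITIVELY on every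
fibre presents `p` (assumed onto) as the quotient covering map `E → E/G = X`, i.e. Mathlib's
`IsQuotientCoveringMap p G` (free, properly discontinuous, orbits = fibres). With `G` the deck group
of a normal covering (file 3) acting tautologically this reads: «a normal covering is the quotient
covering by its group of deck transformations». [cite: HatcherAT2002, §1.3 Prop. 1.40] -/
theorem isQuotientCoveringMap_of_smul [PreconnectedSpace E] [ContinuousConstSMul G E]
    [FaithfulSMul G E] (hp : IsCoveringMap p) (hsurj : Surjective p)
    (hover : ∀ (g : G) (e : E), p (g • e) = p e)
    (htrans : ∀ e₁ e₂ : E, p e₁ = p e₂ → ∃ g : G, g • e₂ = e₁) : IsQuotientCoveringMap p G := by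
  refine (isQuotientCoveringMap_iff_isCoveringMap_and p G).2 ⟨hp, hsurj, inferInstance, ?_, ?_⟩
  · exact ⟨fun g g' e h => eq_of_smul_eq_smul hp hover h⟩
  · intro e₁ e₂
    rw [MulAction.mem_orbit_iff]
    exact ⟨htrans e₁ e₂, fun ⟨g, hg⟩ => hg ▸ hover g e₂⟩

/-! ### §2 Conversely: the group of a quotient covering is the deck group (Prop. 1.40 (b)) -/

/-- The homeomorphisms `g • ·` of a quotient covering are deck transformations.
[cite: HatcherAT2002, §1.3 Prop. 1.40] -/
theorem _root_.IsQuotientCoveringMap.smul_mem_deckTransformations (hp : IsQuotientCoveringMap p G)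
    (g : G) :
    (letI := hp.toContinuousConstSMul; Homeomorph.smul g : E ≃ₜ E) ∈ deckTransformations p :=
  fun e => hp.map_smul g (e := e)

/-- **Hatcher, Prop. 1.40 (b)**: for a quotient covering map `p : E → X = E/G` with connected total
space, `g ↦ (g • ·)` is an injective group homomorphism `G → (E ≃ₜ E)` whose image is exactly the
group `G(E)` of deck transformations of `p` (a deck transformation `f` agrees with `g • ·` at one
point for the `g` carrying `e` to `f e` in its orbit = fibre, hence everywhere by unique lifting).
[cite: HatcherAT2002, §1.3 Prop. 1.40] -/
theorem _root_.IsQuotientCoveringMap.exists_monoidHom_range_eq_deckTransformations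
    [ConnectedSpace E] (hp : IsQuotientCoveringMap p G) :
    ∃ φ : G →* (E ≃ₜ E), Injective φ ∧ φ.range = deckTransformations p ∧
      ∀ (g : G) (e : E), φ g e = g • e := by
  letI := hp.toContinuousConstSMul
  let φ : G →* (E ≃ₜ E) :=
    { toFun := fun g => Homeomorph.smul g
      map_one' := by ext e; exact one_smul G e
      map_mul' := fun g g' => by ext e; exact mul_smul g g' e }
  have hφ : ∀ (g : G) (e : E), φ g e = g • e := fun _ _ => rfl
  obtain ⟨e⟩ : Nonempty E := inferInstance
  refine ⟨φ, fun g g' h => ?_, ?_, hφ⟩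
  · haveI := hp.isCancelSMul
    exact IsCancelSMul.right_cancel g g' e (by rw [← hφ, ← hφ, h])
  · ext f
    constructor
    · rintro ⟨g, rfl⟩
      exact hp.smul_mem_deckTransformations g
    · intro hf
      -- `f e` lies in the fibre = orbit of `e`
      obtain ⟨g, hg⟩ : f e ∈ MulAction.orbit G e :=
        hp.apply_eq_iff_mem_orbit.1 ((mem_deckTransformations_iff p f).1 hf e)
      refine ⟨g, deck_eq_of_apply_eq hp.isCoveringMap (hp.smul_mem_deckTransformations g) hf
        (y := e) ?_⟩
      rw [← hg]
      rfl

/-- **Prop. 1.40 (b)**: the group of a quotient covering with connected total space is isomorphic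
to the deck group. [cite: HatcherAT2002, §1.3 Prop. 1.40] -/
theorem _root_.IsQuotientCoveringMap.nonempty_mulEquiv_deckTransformations [ConnectedSpace E]
    (hp : IsQuotientCoveringMap p G) : Nonempty (G ≃* deckTransformations p) := by
  obtain ⟨φ, hinj, hrange, -⟩ := hp.exists_monoidHom_range_eq_deckTransformations
  exact ⟨(MonoidHom.ofInjective hinj).trans (MulEquiv.subgroupCongr hrange)⟩

/-- A quotient covering is NORMAL in the sense of file 3: its deck group is transitive on every
fibre (already the elements `g • ·` are). [cite: HatcherAT2002, §1.3 Prop. 1.40] -/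
theorem _root_.IsQuotientCoveringMap.forall_exists_deck_apply_eq (hp : IsQuotientCoveringMap p G)
    (x : X) (e e' : p ⁻¹' {x}) : ∃ f ∈ deckTransformations p, f e = e' := by
  letI := hp.toContinuousConstSMul
  obtain ⟨g, hg⟩ : (e' : E) ∈ MulAction.orbit G (e : E) :=
    hp.apply_eq_iff_mem_orbit.1 (e'.2.trans e.2.symm)
  exact ⟨Homeomorph.smul g, hp.smul_mem_deckTransformations g, hg⟩

/-- Hence (file 3, Prop. 1.39 (a)) `p_* π₁(E, e₀)` is normal for a quotient covering with
path-connected, locally path-connected total space — the deck-transformation route to the tree's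
`QuotientCovering.normal_range_mapOfEq` (which has no connectedness hypothesis, via the kernel of
the monodromy). [cite: HatcherAT2002, §1.3 Prop. 1.39] -/
theorem _root_.IsQuotientCoveringMap.normal_range_mapOfEq' [PathConnectedSpace E]
    [LocallyPathConnectedSpace E] (hp : IsQuotientCoveringMap p G) {x₀ : X} (e₀ : p ⁻¹' {x₀}) :
    (FundamentalGroup.mapOfEq ⟨p, hp.isCoveringMap.continuous⟩ e₀.2).range.Normal :=
  (forall_exists_deck_apply_eq_iff_normal hp.isCoveringMap e₀).1 hp.forall_exists_deck_apply_eq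

/-- **Prop. 1.40 (b)+(c) combined with Prop. 1.39 (b)**: for a quotient covering `p : E → X = E/G`
with path-connected, locally path-connected total space, `G ≅ G(E) ≅ π₁(X, x₀)/p_* π₁(E, e₀)`.
[cite: HatcherAT2002, §1.3 Prop. 1.40] -/
theorem _root_.IsQuotientCoveringMap.nonempty_mulEquiv_quotient_range [PathConnectedSpace E]
    [LocallyPathConnectedSpace E] (hp : IsQuotientCoveringMap p G) {x₀ : X} (e₀ : p ⁻¹' {x₀}) :
    (haveI := hp.normal_range_mapOfEq' e₀
     Nonempty (G ≃* (FundamentalGroup X x₀ ⧸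
      (FundamentalGroup.mapOfEq ⟨p, hp.isCoveringMap.continuous⟩ e₀.2).range))) := by
  haveI := hp.normal_range_mapOfEq' e₀
  obtain ⟨e₁⟩ := hp.nonempty_mulEquiv_deckTransformations
  obtain ⟨e₂⟩ := nonempty_mulEquiv_quotient_of_normal hp.isCoveringMap e₀ (hp.normal_range_mapOfEq' e₀)
  exact ⟨e₁.trans e₂.symm⟩

end CoverDeck

end Literature.Topology.CoveringSpaces
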